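import Mathlib
import HarnessLib
import HarnessLib.Audit
import Summits.HodgeConjecture.HodgeConjecture.Theses.IncidenceNodePeeling
import Summits.HodgeConjecture.HodgeConjecture.Theses.AnchorTransport
import Literature.AlgebraicGeometry.HodgeTheory.IsoTransport

/-!
# Line `birth` — BC3 skeleton for the crux `HCMovablePairs` (stmt-HodgeConjecture-2348)

Route `IncidenceNodePeeling` (route-HodgeConjecture-IncidenceNodePeeling), crux of rank 5
`HCMovablePairs`: for a smooth hypersurface `X ⊂ ℙ^{2p+1}_ℂ` of degree `d` and a rational `(p,p)`-class
`ζ ∈ H²ᵖ(X(ℂ);ℂ)` whose pair `(X, ζ)` is MOVABLE (there is a non-isotrivial smooth projective family of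
degree-`d` hypersurfaces over an irreducible base, `X` a fibre, with a global rational class restricting to
`ζ` on `X` and to a `(p,p)`-class on every fibre — equivalently the Hodge-locus component of `ζ` in `|O(d)|`
is positive-dimensional modulo `PGL`), `ζ` is algebraic.

THE LINE = NODAL EXHAUSTION, exactly the decomposition the route header announces
("HCMovablePairs — the formal shadow of NodalExhaustion = ForcingCaseB ∧ EndStateSupported ∧
ReturnAlongHodgeLocus"; "it propagates back, one degeneration step at a time and then along the smooth
part of each Hodge-locus component"), typed on the carriers that landed 2026-08-15 (`IsNode`,
`IsSpecialisingNhd` / `specialisationMap`, `vanishingHomology`, `tubeOver` / `fiberRestrict`, `cupPairing`):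

* `stub_supportedNodalDegeneration` — FORCING + PEELING + END STATE (the route's informal cruxes
  ForcingCaseB stmt-2474 and EndStateSupported stmt-2488 with the support PeelingBound stmt-2352, in the
  collapsed form "end = the k-nodal fibre `X_k`" that the typed return step consumes, together with the
  Cattani–Deligne–Kaplan / fixed-part family over the Hodge-locus component): every movable pair `(X, ζ)`
  sits, up to isomorphism, in a smooth projective family `g : 𝒴 ⟶ T` of smooth degree-`d` hypersurfaces over
  a smooth irreducible base carrying a global fibrewise-rational-`(p,p)` class `Θ` with `Θ|_{t₂} = e₂^* ζ`
  (`e₂ : 𝒴_{t₂} ≅ X`), AND some fibre `𝒴_{t₁}` of that family is (≅) the nearby smooth fibre `𝒳_t` of a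
  ONE-STEP DEGENERATION `f : 𝒳 ⟶ S` (proper, flat; `U ∋ t₀` a specialising neighbourhood; fibres over
  `U ∖ {t₀}` smooth projective of dimension `2p`; the special fibre `𝒳_{t₀}` with exactly `k` singular
  points, all even-dimensional nodes; vanishing cycles `δ₁ … δ_k` rational, pairwise orthogonal,
  non-isotropic, their Poincaré duals spanning the vanishing homology) INSIDE THE HODGE LOCUS (the class
  `ζ_t := e₁^*(Θ|_{t₁})` extends over the punctured tube to a fibrewise rational `(p,p)` class) whose
  RESIDUAL `ζ_t − Σ_i (⟨ζ_t,δ_i⟩/⟨δ_i,δ_i⟩) δ_i` is the specialisation `sp(α)` of an ALGEBRAIC class `α`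
  on the nodal fibre (supported in codimension `p`: the end state).
* `stub_returnAcrossNodes : ReturnAlongHodgeLocus` — the route's own typed crux stmt-HodgeConjecture-13854,
  cited BY NAME (return across the nodes of ONE degeneration: `sp(α)` algebraic residual ⇒ `ζ_t` algebraic on
  the nearby smooth fibre; `k = 0` = Grothendieck's local variational Hodge statement).
* `stub_propagationAlongHodgeLocus` — propagation of algebraicity along the smooth part of the Hodge-locus
  component: the variational Hodge statement for smooth projective families of smooth `2p`-dimensional
  degree-`d` HYPERSURFACES over a smooth irreducible base with a global fibrewise-rational-`(p,p)` class
  (algebraic on one fibre ⇒ algebraic on every fibre). It is the hypersurface case of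
  `AnchorTransport.VariationalHodge` (stmt-HodgeConjecture-1076): `propagationAlongHodgeLocus_of_variationalHodge`
  below is the one-line specialisation (kernel-checked, no sorry), so a proof of 1076 closes this stub, while
  the stub itself stays open to hypersurface tools (Jacobian-ring IVHS, Otwinowska / Dan / Movasati–Villaflor
  variational HC on components of Hodge loci of hypersurfaces).
* `HCMovablePairs_of : SupportedNodalDegeneration → ReturnAlongHodgeLocus → PropagationAlongHodgeLocus →
  HCMovablePairs` — THE skeleton theorem, a REAL proof (no sorry; axioms {propext, Classical.choice, Quot.sound});
  `HCMovablePairs_of_stubs : HCMovablePairs` instantiates it with the three stubs (the hypothesis-free target the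
  skeleton audit keys on). Proof: from the movable pair take the data of stub 1; transport rationality and
  Hodge type of `Θ|_{t₁}` across `e₁` (`isRationalClass_map_iff_of_iso`, `isOfHodgeType_map_iff_of_iso`);
  apply `ReturnAlongHodgeLocus` to get `ζ_t` algebraic on `𝒳_t`; transport back across `e₁`
  (`mem_algebraicClasses_map_iff_of_iso`) to the anchor `Θ|_{t₁}` algebraic; propagate along `g` to `t₂`
  (stub 3); rewrite `Θ|_{t₂} = e₂^* ζ` and transport across `e₂`.

`sorry` occurs ONLY in the three `stub_*` theorems. Honest status: all three stubs are classically implied by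
the Hodge conjecture (stub 1 via constant families and `k = 0`; stub 2 by the refuter-recorded sandwich
HC ⇒ ReturnAlongHodgeLocus ⇒ local VHC; stub 3 fibrewise, `propagationAlongHodgeLocus_of_hodgeConjecture`
below), as every statement in this area is; none implies the crux or the summit cheaply (BC3 probes, seat
folder `bc/probe_*.lean`): stub 1 produces an anchor only on a NODAL fibre and needs stubs 2+3 to come back,
stub 2 needs the degeneration datum, stub 3 needs an anchor.

Disproof used: `Cruxes/HCMovablePairs/` had no workfile before this one (no `Disproof.lean`, no
`_false_without_` theorem, no landed `Theorems/HCMovablePairs/Negative/*`). For the imported shape of stub 3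
the standing analysis `Cruxes/VariationalHodge/Disproof.lean` applies verbatim: the ANCHOR is load-bearing
(`withoutAnchor_iff_hodgeConjecture`; Negative lemma `Theorems/VariationalHodge/Negative/AnchorLoadBearing`) —
honoured: this line manufactures the anchor (stubs 1+2, on the nearby fibre of the nodal degeneration) and
stub 3 keeps the anchor hypothesis; base hypotheses smooth + irreducible kept (irreducibility is what separates
V from HC). Negatives index (3 entries: MilnorKExponential symbol lift, Fermat K3 multisets, E-line matrices):
no stub is an instance.
-/

-- `Summit.<Summit>.<Problem>`: for the single-conjunct summit the duplicate `HodgeConjecture.HodgeConjecture` is mandated.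
set_option linter.dupNamespace false
set_option linter.unusedVariables false

namespace Summit.HodgeConjecture.HodgeConjecture.Cruxes.HCMovablePairs.Birth

open scoped BigOperators

-- The stub STATEMENTS (§1) are written FULLY QUALIFIED on purpose: a prover must be able to restate their text
-- verbatim in a Theorems file importing only the IncidenceNodePeeling route (+ Mathlib/Literature).

/-! ## §1 The stub STATEMENTS (named Props = the admissible hypotheses of `HCMovablePairs_of`)

Stub 2's statement is the route item `IncidenceNodePeeling.ReturnAlongHodgeLocus` itself (tagged `route_item`, cited by
name). The two new statements are declared here as named Props; their `@[stub "birth"]` obligation tags are live in the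
registrar's work copy only conceptually — `crux write` refuses gate-reserved attributes in workfiles, so they are comments
in this tree copy (same convention as the other `Lines/birth.lean` files), and the audit keys on the hypothesis-free
`HCMovablePairs_of_stubs`. A prover restates the Prop text verbatim in a Theorems file and proves
`theorem stub_<name> : <the Prop text>` (`propose --supports stmt-HodgeConjecture-2348`). -/

/-- **Statement of stub 1 — supported nodal degeneration inside the Hodge locus (FORCING + PEELING + END STATE).**
For every MOVABLE pair `(X, ζ)` (hypotheses verbatim those of `HCMovablePairs`) there are
(i) a smooth projective family `g : 𝒴 ⟶ T` of smooth `2p`-dimensional degree-`d` hypersurfaces over a smooth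
irreducible base, points `t₁ t₂`, an iso `e₂ : 𝒴_{t₂} ≅ X` and a global class `Θ ∈ H²ᵖ(𝒴(ℂ);ℂ)`, fibrewise
rational of type `(p,p)`, with `Θ|_{t₂} = e₂^* ζ` — the family over (a resolution of the smooth-member locus
of the normalised closure `Z̄'` of) the Hodge-locus component of `ζ`, algebraic by Cattani–Deligne–Kaplan, the
class single-valued over `Z̄'` and globalised by the theorem of the fixed part; and
(ii) a ONE-STEP DEGENERATION inside the Hodge locus ending on a supported class: `f : 𝒳 ⟶ S` proper flat,
`U ∋ t₀` specialising in degree `2p`, `t ∈ U ∖ {t₀}` with `e₁ : 𝒳_t ≅ 𝒴_{t₁}`, fibres over `U ∖ {t₀}` smooth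
projective of dimension `2p`, the special fibre with exactly `k` singular points, all nodes
(`IsNode ℂ (2p)`), rational vanishing cycles `δ_i` on `𝒳_t` — pairwise orthogonal, non-isotropic, Poincaré
duals spanning the vanishing homology — an extension of `ζ_t := e₁^*(Θ|_{t₁})` over the punctured tube that is
rational `(p,p)` on every fibre, and an ALGEBRAIC class `α` on the nodal fibre `𝒳_{t₀}` with
`sp(α) = ζ_t − Σ_i (⟨ζ_t,δ_i⟩/⟨δ_i,δ_i⟩) δ_i`.
Why plausibly true (the card's engine): FORCING — over a general surface in `Z̄'` the incidence divisor has only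
ambient cohomology (Artin–Lefschetz) while `ζ` comes from `IH`, so the divisor fails to be a `ℚ`-homology
manifold along a curve: a divisor of 1-nodal members with `⟨ζ,δ⟩ ≠ 0` (Thomas2005Nodes §3, Milnor Thm 8.5,
BrosnanFangNiePearlstein2009 / DecataldoMigliorini2009 H-vs-IH defect); PEELING with kept orthogonal nodes
terminates after `≤ 2q(ζ_v)` steps (PeelingBound, stmt-2352); END STATE — the residual limit class is carried
by codimension-`p` subvarieties of the `k`-nodal `ℚ`-homology manifold `X_k` (EndStateSupported, stmt-2488).
Why it might fail: forcing may produce vertical non-isolated singular loci or non-`A₁` transversal types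
(ForcingCaseB's risk); the end-state class may sit on the singular locus with the wrong coniveau
(Grothendieck1969 phenomena, EndStateSupported's risk); the Hodge locus may be non-reduced (DFV2023 Fermat).
Size: XL (it is the whole degeneration-theoretic half of the line). [cite: Thomas2005Nodes, §3]
[cite: CattaniDeligneKaplan1995, Thm 1.1] [cite: VoisinHodgeII2003, §5.3] -/
-- @[stub "birth"]  (gate-reserved attribute: refused in crux workfiles, hence a comment in this tree copy)
def SupportedNodalDegeneration : Prop :=
  ∀ (p d : ℕ) (X : Literature.AlgebraicGeometry.Motives.SchemeOver ℂ)
    (ζ : Literature.AlgebraicGeometry.HodgeTheory.complexBetti X (2 * p)),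
    Literature.AlgebraicGeometry.Motives.IsSmoothHypersurface (2 * p) d X →
    Literature.AlgebraicGeometry.HodgeTheory.IsRationalClass ζ →
    Literature.AlgebraicGeometry.HodgeTheory.IsOfHodgeType (2 * p) X (2 * p) p p ζ →
    (∃ (S 𝒳 : Literature.AlgebraicGeometry.Motives.SchemeOver ℂ) (f : 𝒳 ⟶ S)
        (s : Literature.AlgebraicGeometry.Motives.ComplexPoints S)
        (e : Literature.AlgebraicGeometry.Motives.fiberOver f s ≅ X)
        (Ξ : Literature.AlgebraicGeometry.HodgeTheory.complexBetti 𝒳 (2 * p)),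
        Literature.AlgebraicGeometry.Motives.IsSmoothProjectiveFamily f (2 * p) ∧
        AlgebraicGeometry.LocallyOfFiniteType S.hom ∧ IrreducibleSpace S.left ∧
        (∀ t : Literature.AlgebraicGeometry.Motives.ComplexPoints S,
          Literature.AlgebraicGeometry.Motives.IsSmoothHypersurface (2 * p) d
            (Literature.AlgebraicGeometry.Motives.fiberOver f t)) ∧
        (∃ t : Literature.AlgebraicGeometry.Motives.ComplexPoints S,
          IsEmpty (Literature.AlgebraicGeometry.Motives.fiberOver f t ≅
            Literature.AlgebraicGeometry.Motives.fiberOver f s)) ∧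
        Literature.AlgebraicGeometry.HodgeTheory.IsRationalClass Ξ ∧
        (∀ t : Literature.AlgebraicGeometry.Motives.ComplexPoints S,
          Literature.AlgebraicGeometry.HodgeTheory.IsOfHodgeType (2 * p)
            (Literature.AlgebraicGeometry.Motives.fiberOver f t) (2 * p) p p
            ((Literature.AlgebraicGeometry.HodgeTheory.complexBetti.map
              (Literature.AlgebraicGeometry.Motives.fiberι f t) (2 * p)).hom Ξ)) ∧
        (Literature.AlgebraicGeometry.HodgeTheory.complexBetti.map
            (Literature.AlgebraicGeometry.Motives.fiberι f s) (2 * p)).hom Ξ =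
          (Literature.AlgebraicGeometry.HodgeTheory.complexBetti.map e.hom (2 * p)).hom ζ) →
    ∃ (𝒴 T : Literature.AlgebraicGeometry.Motives.SchemeOver ℂ) (g : 𝒴 ⟶ T)
      (t₁ t₂ : Literature.AlgebraicGeometry.Motives.ComplexPoints T)
      (e₂ : Literature.AlgebraicGeometry.Motives.fiberOver g t₂ ≅ X)
      (Θ : Literature.AlgebraicGeometry.HodgeTheory.complexBetti 𝒴 (2 * p)),
      Literature.AlgebraicGeometry.Motives.IsSmoothProjectiveFamily g (2 * p) ∧
      IrreducibleSpace T.left ∧ AlgebraicGeometry.Smooth T.hom ∧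
      (∀ s : Literature.AlgebraicGeometry.Motives.ComplexPoints T,
        Literature.AlgebraicGeometry.Motives.IsSmoothHypersurface (2 * p) d
          (Literature.AlgebraicGeometry.Motives.fiberOver g s)) ∧
      (∀ s : Literature.AlgebraicGeometry.Motives.ComplexPoints T,
        Literature.AlgebraicGeometry.HodgeTheory.IsRationalClass
            (Literature.AlgebraicGeometry.HodgeTheory.complexBetti.map
              (Literature.AlgebraicGeometry.Motives.fiberι g s) (2 * p) Θ) ∧
          Literature.AlgebraicGeometry.HodgeTheory.IsOfHodgeType (2 * p)
            (Literature.AlgebraicGeometry.Motives.fiberOver g s) (2 * p) p p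
            (Literature.AlgebraicGeometry.HodgeTheory.complexBetti.map
              (Literature.AlgebraicGeometry.Motives.fiberι g s) (2 * p) Θ)) ∧
      Literature.AlgebraicGeometry.HodgeTheory.complexBetti.map
          (Literature.AlgebraicGeometry.Motives.fiberι g t₂) (2 * p) Θ =
        Literature.AlgebraicGeometry.HodgeTheory.complexBetti.map e₂.hom (2 * p) ζ ∧
      ∃ (k : ℕ) (𝒳 S : Literature.AlgebraicGeometry.Motives.SchemeOver ℂ) (f : 𝒳 ⟶ S)
        (t₀ t : Literature.AlgebraicGeometry.Motives.ComplexPoints S)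
        (U : _root_.Set (Literature.AlgebraicGeometry.Motives.ComplexPoints S))
        (hU : Literature.AlgebraicGeometry.HodgeTheory.IsSpecialisingNhd f t₀ (2 * p) U)
        (ht : t ∈ U) (ht' : t ∈ U \ {t₀})
        (e₁ : Literature.AlgebraicGeometry.Motives.fiberOver f t ≅
          Literature.AlgebraicGeometry.Motives.fiberOver g t₁)
        (μ : Literature.AlgebraicTopology.SingularHomology.HomologicalOrientation ℂ
          (Literature.AlgebraicGeometry.Motives.ComplexPoints
            (Literature.AlgebraicGeometry.Motives.fiberOver f t)) (2 * (2 * p)))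
        (δ : Fin k → Literature.AlgebraicGeometry.HodgeTheory.complexBetti
          (Literature.AlgebraicGeometry.Motives.fiberOver f t) (2 * p)),
        AlgebraicGeometry.IsProper f.left ∧ AlgebraicGeometry.Flat f.left ∧
        (∃ N : Finset ↥(Literature.AlgebraicGeometry.Motives.fiberOver f t₀).left, N.card = k ∧
          (∀ x : ↥(Literature.AlgebraicGeometry.Motives.fiberOver f t₀).left, x ∈ N ↔
            ¬ IsRegularLocalRing
              ((Literature.AlgebraicGeometry.Motives.fiberOver f t₀).left.presheaf.stalk x)) ∧
          ∀ x ∈ N, IsClosed ({x} : _root_.Set ↥(Literature.AlgebraicGeometry.Motives.fiberOver f t₀).left) ∧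
            Literature.AlgebraicGeometry.HodgeTheory.IsNode ℂ (2 * p) x) ∧
        (∀ s ∈ U \ {t₀}, Literature.AlgebraicGeometry.Motives.IsSmoothProjective (2 * p)
          (Literature.AlgebraicGeometry.Motives.fiberOver f s)) ∧
        (∀ i, Literature.AlgebraicGeometry.HodgeTheory.IsRationalClass (δ i)) ∧
        Submodule.span ℂ (_root_.Set.range fun i =>
            Literature.AlgebraicTopology.SingularHomology.poincareDualityMap μ
              (two_mul (2 * p)).symm (δ i)) =
          Literature.AlgebraicGeometry.HodgeTheory.vanishingHomology ℂ f ht (2 * p) ∧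
        (∀ i j, i ≠ j →
          Literature.AlgebraicTopology.SingularHomology.cupPairing μ (two_mul (2 * p)).symm
            (δ i) (δ j) = 0) ∧
        (∀ i, Literature.AlgebraicTopology.SingularHomology.cupPairing μ (two_mul (2 * p)).symm
            (δ i) (δ i) ≠ 0) ∧
        (∃ Ξ : Literature.AlgebraicTopology.SingularHomology.singularCohomology ℂ ℂ
            ↥(Literature.AlgebraicGeometry.HodgeTheory.tubeOver f (U \ {t₀})) (2 * p),
          Literature.AlgebraicGeometry.HodgeTheory.fiberRestrict f ht' (2 * p) Ξ =
            Literature.AlgebraicGeometry.HodgeTheory.complexBetti.map e₁.hom (2 * p)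
              (Literature.AlgebraicGeometry.HodgeTheory.complexBetti.map
                (Literature.AlgebraicGeometry.Motives.fiberι g t₁) (2 * p) Θ) ∧
          ∀ (s : Literature.AlgebraicGeometry.Motives.ComplexPoints S) (hs : s ∈ U \ {t₀}),
            Literature.AlgebraicGeometry.HodgeTheory.IsRationalClass
                (Literature.AlgebraicGeometry.HodgeTheory.fiberRestrict f hs (2 * p) Ξ) ∧
              Literature.AlgebraicGeometry.HodgeTheory.IsOfHodgeType (2 * p)
                (Literature.AlgebraicGeometry.Motives.fiberOver f s) (2 * p) p p
                (Literature.AlgebraicGeometry.HodgeTheory.fiberRestrict f hs (2 * p) Ξ)) ∧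
        (∃ α ∈ Literature.AlgebraicGeometry.HodgeTheory.algebraicClasses
            (Literature.AlgebraicGeometry.Motives.fiberOver f t₀) p,
          Literature.AlgebraicGeometry.HodgeTheory.specialisationMap hU ht α =
            Literature.AlgebraicGeometry.HodgeTheory.complexBetti.map e₁.hom (2 * p)
                (Literature.AlgebraicGeometry.HodgeTheory.complexBetti.map
                  (Literature.AlgebraicGeometry.Motives.fiberι g t₁) (2 * p) Θ) -
              ∑ i : Fin k,
                (Literature.AlgebraicTopology.SingularHomology.cupPairing μ (two_mul (2 * p)).symm
                    (Literature.AlgebraicGeometry.HodgeTheory.complexBetti.map e₁.hom (2 * p)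
                      (Literature.AlgebraicGeometry.HodgeTheory.complexBetti.map
                        (Literature.AlgebraicGeometry.Motives.fiberι g t₁) (2 * p) Θ))
                    (δ i) /
                  Literature.AlgebraicTopology.SingularHomology.cupPairing μ (two_mul (2 * p)).symm
                    (δ i) (δ i)) • δ i)

/-- **Statement of stub 3 — propagation along the smooth part of the Hodge locus** (variational Hodge statement for
HYPERSURFACE families; the `k = 0` step of the line, globalised). For a smooth projective family `g : 𝒴 ⟶ T`
of smooth `2p`-dimensional degree-`d` hypersurfaces over a smooth irreducible base and a global class
`Θ ∈ H²ᵖ(𝒴(ℂ);ℂ)` that is rational of type `(p,p)` on every fibre (i.e. the family lies in the Hodge locus of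
`Θ`): if `Θ|_{𝒴_{s₀}}` is algebraic for one `s₀`, it is algebraic on every fibre. Why plausibly true: it is the
hypersurface case of Grothendieck's variational Hodge conjecture `AnchorTransport.VariationalHodge`
(stmt-HodgeConjecture-1076; `propagationAlongHodgeLocus_of_variationalHodge` below), implied by HC
(`propagationAlongHodgeLocus_of_hodgeConjecture` below) and by the standard conjectures (André, via
Charles–Schnell remark after Thm 11.3.8); for hypersurfaces the infinitesimal theory is explicit (Jacobian-ring
IVHS: Carlson–Griffiths; variational HC proved for complete intersections of low degree in hypersurfaces and on
components of maximal / small codimension of the Hodge locus: Otwinowska2003, Dan, MovasatiVillaflor,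
Kloosterman2025). Why it might fail: false only with HC; as a strategy it stalls where semiregularity / the
algebraisation of formal lifts (Bloch–Esnault–Kerz) is missing, and on non-reduced components of the Hodge
locus (DuquefrancoVillaflorloyola2023: fake linear cycles). Size: XL (open).
[cite: CharlesSchnell2014Notes, Conj. 11.3.1 and Cor. 11.3.6] [cite: Bloch1972Semiregularity, Thm 7.3]
[cite: BlochEsnaultKerz2014CharZero, Thm 2] [cite: Kloosterman2025, Thm 1.1] -/
-- @[stub "birth"]  (gate-reserved attribute: refused in crux workfiles, hence a comment in this tree copy)
def PropagationAlongHodgeLocus : Prop :=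
  ∀ (p d : ℕ) (𝒴 T : Literature.AlgebraicGeometry.Motives.SchemeOver ℂ) (g : 𝒴 ⟶ T),
    Literature.AlgebraicGeometry.Motives.IsSmoothProjectiveFamily g (2 * p) →
    IrreducibleSpace T.left → AlgebraicGeometry.Smooth T.hom →
    (∀ s : Literature.AlgebraicGeometry.Motives.ComplexPoints T,
      Literature.AlgebraicGeometry.Motives.IsSmoothHypersurface (2 * p) d
        (Literature.AlgebraicGeometry.Motives.fiberOver g s)) →
    ∀ (Θ : Literature.AlgebraicGeometry.HodgeTheory.complexBetti 𝒴 (2 * p)),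
      (∀ s : Literature.AlgebraicGeometry.Motives.ComplexPoints T,
        Literature.AlgebraicGeometry.HodgeTheory.IsRationalClass
            (Literature.AlgebraicGeometry.HodgeTheory.complexBetti.map
              (Literature.AlgebraicGeometry.Motives.fiberι g s) (2 * p) Θ) ∧
          Literature.AlgebraicGeometry.HodgeTheory.IsOfHodgeType (2 * p)
            (Literature.AlgebraicGeometry.Motives.fiberOver g s) (2 * p) p p
            (Literature.AlgebraicGeometry.HodgeTheory.complexBetti.map
              (Literature.AlgebraicGeometry.Motives.fiberι g s) (2 * p) Θ)) →
      (∃ s₀ : Literature.AlgebraicGeometry.Motives.ComplexPoints T,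
        Literature.AlgebraicGeometry.HodgeTheory.complexBetti.map
            (Literature.AlgebraicGeometry.Motives.fiberι g s₀) (2 * p) Θ ∈
          Literature.AlgebraicGeometry.HodgeTheory.algebraicClasses
            (Literature.AlgebraicGeometry.Motives.fiberOver g s₀) p) →
      ∀ s : Literature.AlgebraicGeometry.Motives.ComplexPoints T,
        Literature.AlgebraicGeometry.HodgeTheory.complexBetti.map
            (Literature.AlgebraicGeometry.Motives.fiberι g s) (2 * p) Θ ∈
          Literature.AlgebraicGeometry.HodgeTheory.algebraicClasses
            (Literature.AlgebraicGeometry.Motives.fiberOver g s) p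

/-! ## §2 The three registered stubs (`sorry` lives ONLY here) -/

/-- **Stub 1** — `SupportedNodalDegeneration` (statement, mechanism, risks and sources: its docstring above). The
HARDEST stub: it is the whole degeneration-theoretic half of the line; its own intended split is the route's informal
ForcingCaseB (stmt-2474) ∧ PeelingBound (stmt-2352, typed) ∧ EndStateSupported (stmt-2488), to be typed once the filed
definition requests (intersection cohomology on complex points, the discriminant of `|O(d)|`, Hodge-locus components as
varieties) land. [cite: Thomas2005Nodes, §3] -/
theorem stub_supportedNodalDegeneration : SupportedNodalDegeneration := by
  sorry

/-- **Stub 2 — return across the nodes of one degeneration** (= this route's typed crux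
stmt-HodgeConjecture-13854, `IncidenceNodePeeling.ReturnAlongHodgeLocus`, verbatim BY NAME). For a proper flat
family `f : 𝒳 ⟶ S`, a specialising neighbourhood `U ∋ t₀` in degree `2p`, `t ∈ U ∖ {t₀}`, fibres over
`U ∖ {t₀}` smooth projective of dimension `2p`, the special fibre with exactly `k` singular points, all nodes,
rational vanishing cycles `δ_i` on `𝒳_t` (orthogonal, non-isotropic, Poincaré duals spanning the vanishing
homology), and a rational `(p,p)`-class `ζ` on `𝒳_t` extending over the punctured tube as a fibrewise rational
`(p,p)` class: if `ζ − Σ_i (⟨ζ,δ_i⟩/⟨δ_i,δ_i⟩) δ_i = sp(α)` with `α` ALGEBRAIC on the nodal fibre, then `ζ` is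
algebraic. Why plausibly true: `k = 0` is Grothendieck's local variational Hodge statement (Bloch 1972
semiregularity, Buchweitz–Flenner 2003 Thm 5.1, Bloch–Esnault–Kerz 2014 Thm 2 for the formal half); `k ≥ 1`:
blow up the (factorial, `p ≥ 2`) base-changed nodes and return the pre-log cycle `W̃ + Σ V_i` (Thomas2005Nodes
§3, Schoen1985 Lemma 1.1). Why it might fail: no log-semiregularity theorem for pre-log cycles on the snc fibre
`X̃₀ ∪ Q_i` when `p ≥ 2`; non-reduced Hodge loci. Size: XL (open; sandwiched between HC and local VHC by the
refuter-recorded reductions). [cite: Thomas2005Nodes, §3] [cite: Bloch1972Semiregularity, Thm 7.3]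
[cite: BuchweitzFlenner2003, Thm 5.1] [cite: BlochEsnaultKerz2014CharZero, Thm 2] -/
theorem stub_returnAcrossNodes :
    Summit.HodgeConjecture.HodgeConjecture.Theses.IncidenceNodePeeling.ReturnAlongHodgeLocus := by
  sorry

/-- **Stub 3** — `PropagationAlongHodgeLocus` (statement, mechanism, risks and sources: its docstring above); the
hypersurface case of `AnchorTransport.VariationalHodge` (`propagationAlongHodgeLocus_of_variationalHodge`, §4).
[cite: CharlesSchnell2014Notes, Conj. 11.3.1 and Cor. 11.3.6] -/
theorem stub_propagationAlongHodgeLocus : PropagationAlongHodgeLocus := by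
  sorry

/-! ## §3 The composition: the three stubs prove the crux BY NAME (sorry-free) -/

/-- **THE SKELETON THEOREM** (BC3 shape `stub₁-sig → stub₂-sig → stub₃-sig → crux`, conclusion = the route decl
`Summit.HodgeConjecture.HodgeConjecture.Theses.IncidenceNodePeeling.HCMovablePairs` BY NAME). Real proof: from a
movable pair `(X, ζ)` stub 1 gives the Hodge-locus family `(g, Θ, t₁, t₂, e₂)` and the supported nodal
degeneration `(f, t₀, t, U, e₁, μ, δ, Ξ, α)`; the class `ζ_t := e₁^*(Θ|_{t₁})` is rational of type `(p,p)`
(transport across `e₁`); `ReturnAlongHodgeLocus` makes `ζ_t` algebraic on `𝒳_t`; transport across `e₁` makes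
`Θ|_{t₁}` algebraic — the ANCHOR; stub 3 propagates algebraicity along `g` to `t₂`; finally
`Θ|_{t₂} = e₂^* ζ` and transport across `e₂` give `ζ ∈ algebraicClasses X p`. [folklore] -/
theorem HCMovablePairs_of :
    SupportedNodalDegeneration →
    Summit.HodgeConjecture.HodgeConjecture.Theses.IncidenceNodePeeling.ReturnAlongHodgeLocus →
    PropagationAlongHodgeLocus →
    Summit.HodgeConjecture.HodgeConjecture.Theses.IncidenceNodePeeling.HCMovablePairs := by
  intro hEx hRet hProp p d X ζ hX hq hpp hmov
  unfold SupportedNodalDegeneration at hEx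
  unfold PropagationAlongHodgeLocus at hProp
  obtain ⟨𝒴, T, g, t₁, t₂, e₂, Θ, hg, hirr, hsm, hhyp, hΘ, hΘζ, k, 𝒳, S, f, t₀, t, U, hU, ht, ht',
    e₁, μ, δ, hprop, hflat, hnodes, hsmooth, hδq, hspan, horth, hnoniso, hΞ, hα⟩ :=
    hEx p d X ζ hX hq hpp hmov
  -- the class on the nearby smooth fibre `𝒳_t ≅ 𝒴_{t₁}` of the degeneration is rational of type `(p,p)`
  have hζt_q : Literature.AlgebraicGeometry.HodgeTheory.IsRationalClass
      (Literature.AlgebraicGeometry.HodgeTheory.complexBetti.map e₁.hom (2 * p)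
        (Literature.AlgebraicGeometry.HodgeTheory.complexBetti.map
          (Literature.AlgebraicGeometry.Motives.fiberι g t₁) (2 * p) Θ)) :=
    (Literature.AlgebraicGeometry.HodgeTheory.isRationalClass_map_iff_of_iso e₁).2 (hΘ t₁).1
  have hζt_pp : Literature.AlgebraicGeometry.HodgeTheory.IsOfHodgeType (2 * p)
      (Literature.AlgebraicGeometry.Motives.fiberOver f t) (2 * p) p p
      (Literature.AlgebraicGeometry.HodgeTheory.complexBetti.map e₁.hom (2 * p)
        (Literature.AlgebraicGeometry.HodgeTheory.complexBetti.map
          (Literature.AlgebraicGeometry.Motives.fiberι g t₁) (2 * p) Θ)) :=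
    (Literature.AlgebraicGeometry.HodgeTheory.isOfHodgeType_map_iff_of_iso e₁).2 (hΘ t₁).2
  -- RETURN across the nodes: the residual is `sp(α)` with `α` algebraic, so `ζ_t` is algebraic on `𝒳_t`
  have h₁ := hRet p k 𝒳 S f t₀ t U hU ht ht' hprop hflat hnodes hsmooth μ δ hδq hspan horth hnoniso _
    hζt_q hζt_pp hΞ hα
  -- across `e₁`: the ANCHOR `Θ|_{t₁}` is algebraic on `𝒴_{t₁}`
  have h₂ : Literature.AlgebraicGeometry.HodgeTheory.complexBetti.map
      (Literature.AlgebraicGeometry.Motives.fiberι g t₁) (2 * p) Θ ∈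
        Literature.AlgebraicGeometry.HodgeTheory.algebraicClasses
          (Literature.AlgebraicGeometry.Motives.fiberOver g t₁) p :=
    (Literature.AlgebraicGeometry.HodgeTheory.mem_algebraicClasses_map_iff_of_iso e₁).1 h₁
  -- PROPAGATION along the Hodge-locus family `g` from `t₁` to `t₂`
  have h₃ := hProp p d 𝒴 T g hg hirr hsm hhyp Θ hΘ ⟨t₁, h₂⟩ t₂
  rw [hΘζ] at h₃
  -- across `e₂ : 𝒴_{t₂} ≅ X`
  exact (Literature.AlgebraicGeometry.HodgeTheory.mem_algebraicClasses_map_iff_of_iso e₂).1 h₃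

/-- **Registered target of the skeleton** — the crux BY NAME with NO hypotheses: `HCMovablePairs_of` applied to the three
declared stubs (the crux modulo exactly the registered stubs; `#print axioms` reaches `sorryAx` precisely through the three
`stub_*`, so it is NOT a proof of the item and closes nothing until the stubs land). `#h21_check_skeleton` keys on a
hypothesis-free theorem concluding the crux by name. -/
theorem HCMovablePairs_of_stubs :
    Summit.HodgeConjecture.HodgeConjecture.Theses.IncidenceNodePeeling.HCMovablePairs :=
  HCMovablePairs_of stub_supportedNodalDegeneration stub_returnAcrossNodes stub_propagationAlongHodgeLocus

/-! ## §4 Recorded relations (sorry-free): where the stubs sit -/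

/-- Stub 3 is the HYPERSURFACE CASE of `AnchorTransport.VariationalHodge` (stmt-HodgeConjecture-1076): drop the
hypersurface hypothesis. So a proof of that shared crux closes stub 3 at once. [folklore] -/
theorem propagationAlongHodgeLocus_of_variationalHodge
    (hV : Summit.HodgeConjecture.HodgeConjecture.Theses.AnchorTransport.VariationalHodge) :
    PropagationAlongHodgeLocus :=
  fun p _d _𝒴 _T g hg hirr hsm _ Θ hΘ hanchor s => hV g hg hirr hsm p Θ hΘ hanchor s

/-- `S → stub 3` (recorded converse probe): stub 3 is a CONSEQUENCE of the summit — fibrewise, the anchor and the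
base hypotheses unused (`HodgeConjectureFor n X` is `Nonempty (HodgeModel n X) ∧` "every rational `(k,k)`-class
is algebraic", and `IsSmoothHypersurface n d X` begins with `IsSmoothProjective n X`). [folklore] -/
theorem propagationAlongHodgeLocus_of_hodgeConjecture (h : _root_.HodgeConjecture) :
    PropagationAlongHodgeLocus :=
  fun p _d _𝒴 _T g _ _ _ hhyp Θ hΘ _ s => (h (hhyp s).1).2 p _ (hΘ s).1 (hΘ s).2

/-- `S → crux` (recorded converse probe): the crux is a CONSEQUENCE of the summit (the movable datum unused).
It is used TOWARD the summit through the route's `closes`. [folklore] -/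
example (h : _root_.HodgeConjecture) :
    Summit.HodgeConjecture.HodgeConjecture.Theses.IncidenceNodePeeling.HCMovablePairs :=
  fun p _d _X ζ hX hq hpp _ => (h hX.1).2 p ζ hq hpp

end Summit.HodgeConjecture.HodgeConjecture.Cruxes.HCMovablePairs.Birth
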